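import Summits.QuantumFields.BalabanUV.T4Continuum.Support.AveragingDeficitLocality

/-!
# AveragingDeficitNearIdentity (T⁴ programme, node NE3, row NE3-R2; file 3/3 of the transport layer) — the
# NEAR-IDENTITY comparison `‖(δ_ψV)(Γ) − ψ(Γ)‖ ≤ 2|Γ|β·Σ_{b⊂Γ}‖ψ(b)‖` of the linearised transport with the abelian contour
# functional, and the consumer tools: `Ad` bookkeeping, the Wilson-weight pairing against the flux, covariant telescoping
# of a plaquette function along a word, word sums against box sums

Purpose, honest framing, citation header and placement: see the header of `AveragingDeficitTransport` (file 1/3).  In one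
sentence: in the axial gauge of B7 p. 24 every bond variable near the coarse plaquette is within `β = O(L·a)` of `1`
(`B7Prop1Explicit.axial_bond_bound`), and then the linearised transport `(δ_ψV)(Γ)` of file 1 is the PLAIN signed sum
`ψ(Γ) = B7Prop1Explicit.asum ψ Γ` up to `2|Γ|β·Σ_{b⊂Γ}‖ψ(b)‖` (`norm_dhol_sub_asum_le`) — the derivative-level analogue
of `B7Prop1Explicit.walk_linear`, which is what lets the tree's `corner_cancellation` + `stokes` (48) turn the derivative
of the average (42) into the stencil average of the curl (B7 p. 28: «the product over `b` replaced by the sum»); plus the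
only matrix analysis the FINE side of β needs, `|Re tr(GC) − Re tr(G log C)| ≤ 4‖C − 1‖²‖G‖` for skew `G`
(`abs_nReTr_mul_sub_mul_mlog_le`), and the covariant telescoping `‖Ad_{V(Γ)}F(x + disp Γ) − F(x)‖ ≤ Σ_{b⊂Γ}‖∇_VF(b)‖`
against the tree's `covGrad` (the mechanism of the main bilinear term (M)).  All statements are [folklore] matrix
calculus / bookkeeping on the tree's transcriptions of [Balaban1985Averaging] (9), (19), (42), (56), p. 28 and of
[Balaban1985Variational] (5) (the Wilson weight); `[cite:]` tags are CONTEXT; nothing printed is a hypothesis; NOT β,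
NOT NE3, no BetaPertH/(B)/(B^μ); finite-T⁴ rung (B)+1, not Clay.
-/

set_option autoImplicit false

open scoped BigOperators Matrix Matrix.Norms.L2Operator Topology
open NormedSpace Finset Filter

namespace Summit.QuantumFields.BalabanUV.T4Continuum.AveragingDeficitNearIdentity

open Literature.MathematicalPhysics.QuantumFieldTheory.Balaban1983to89

open B7Prop1Explicit B7Prop2Explicit MatrixLog UnitaryModel
open T4AveragingDeficitWall hiding Site Plane Plaq Bond
open T4AveragingDeficitNonAbelian (Ad_mul Ad_sub)
open AveragingDeficitTransport AveragingDeficitLocality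

noncomputable section

variable {d : ℕ} {n : Type*} [Fintype n] [DecidableEq n]

local notation "𝕄" => Matrix n n ℂ
local notation "Site" => B7Prop1Explicit.Site

/-! ## §4 The near-identity regime: `(δ_ψV)(Γ)` against the abelian functional `ψ(Γ) = Σ_{b⊂Γ} ±ψ(b)` -/

/-- `‖Ad_u X − X‖ ≤ 2‖u − 1‖‖X‖` for unitary `u`. [folklore] -/
theorem norm_Ad_sub_le [Nonempty n] {u : 𝕄ˣ} (hu : u ∈ unitaryUnits 𝕄) (X : 𝕄) :
    ‖Ad u X - X‖ ≤ 2 * ‖(u : 𝕄) - 1‖ * ‖X‖ := by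
  have hUi : ‖((u⁻¹ : 𝕄ˣ) : 𝕄)‖ = 1 :=
    CStarRing.norm_of_mem_unitary (mem_unitaryUnits.mp ((unitaryUnits 𝕄).inv_mem hu))
  have hinv : ‖((u⁻¹ : 𝕄ˣ) : 𝕄) - 1‖ ≤ ‖(u : 𝕄) - 1‖ :=
    norm_inv_sub_one_le (mem_U1_of_unitary hu)
  have e1 : Ad u X - X = ((u : 𝕄) - 1) * X * ((u⁻¹ : 𝕄ˣ) : 𝕄) + X * (((u⁻¹ : 𝕄ˣ) : 𝕄) - 1) := by
    unfold Ad; noncomm_ring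
  rw [e1]
  calc _ ≤ ‖((u : 𝕄) - 1) * X * ((u⁻¹ : 𝕄ˣ) : 𝕄)‖ + ‖X * (((u⁻¹ : 𝕄ˣ) : 𝕄) - 1)‖ := norm_add_le _ _
    _ ≤ ‖(u : 𝕄) - 1‖ * ‖X‖ * ‖((u⁻¹ : 𝕄ˣ) : 𝕄)‖ + ‖X‖ * ‖((u⁻¹ : 𝕄ˣ) : 𝕄) - 1‖ :=
        add_le_add ((norm_mul_le _ _).trans (mul_le_mul_of_nonneg_right (norm_mul_le _ _) (norm_nonneg _)))
          (norm_mul_le _ _)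
    _ ≤ ‖(u : 𝕄) - 1‖ * ‖X‖ * 1 + ‖X‖ * ‖(u : 𝕄) - 1‖ := by
        rw [hUi]; gcongr
    _ = 2 * ‖(u : 𝕄) - 1‖ * ‖X‖ := by ring

/-- `lnorm` is nonnegative. [folklore] -/
theorem lnorm_nonneg (ψ : Site d → Fin d → 𝕄) : ∀ (x : Site d) (w : List (Letter d)), 0 ≤ lnorm ψ x w
  | x, [] => by simp
  | x, l :: w => by rw [lnorm_cons]; exact add_nonneg (norm_nonneg _) (lnorm_nonneg ψ _ w)

/-- In a region where every bond variable of the word is within `β` of `1`, the transport along a word of length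
`m` is within `m·β` of `1` (telescoping on `U(N)`, no exponential). [folklore] -/
theorem norm_hol_sub_one_le_of_bonds [Nonempty n] {V : Site d → Fin d → 𝕄ˣ} (hV : IsUnitaryCfg V) {β : ℝ} :
    ∀ (x : Site d) (w : List (Letter d)),
      (∀ b ∈ bondsOf x w, ‖((V b.1 b.2 : 𝕄ˣ) : 𝕄) - 1‖ ≤ β) → ‖((hol V x w : 𝕄ˣ) : 𝕄) - 1‖ ≤ w.length * β
  | x, [], _ => by simp
  | x, l :: w, h => by
    rw [hol_cons, Units.val_mul, List.length_cons, Nat.cast_succ, add_mul, one_mul]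
    have ih := norm_hol_sub_one_le_of_bonds hV (x + l.vec) w fun b hb => h b (by simp [hb])
    have hU : ∀ x κ, V x κ ∈ U1 𝕄 := fun x κ => mem_U1_of_unitary (hV x κ)
    have hstep : ‖((stepHol V x l : 𝕄ˣ) : 𝕄) - 1‖ ≤ β := by
      have hb := h (if l.2 then (x, l.1) else (x + l.vec, l.1)) (by simp)
      obtain ⟨μ, b⟩ := l
      cases b
      · simp only [Bool.false_eq_true, ↓reduceIte] at hb
        simp only [stepHol, Bool.false_eq_true, ↓reduceIte]
        exact (norm_inv_sub_one_le (hU _ _)).trans hb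
      · simpa [stepHol] using hb
    have hn1 : ‖((stepHol V x l : 𝕄ˣ) : 𝕄)‖ ≤ 1 := (mem_U1.mp (stepHol_mem hU x l)).1
    calc _ ≤ ‖((stepHol V x l : 𝕄ˣ) : 𝕄) - 1‖ + ‖((hol V (x + l.vec) w : 𝕄ˣ) : 𝕄) - 1‖ :=
          B8Ineq170.norm_mul_sub_one_le_of_norm_le_one hn1
      _ ≤ β + w.length * β := add_le_add hstep ih
      _ = w.length * β + β := by ring

/-- **`(δ_ψV)(Γ)` VERSUS THE ABELIAN SUM `ψ(Γ)`**: if every bond variable of `Γ` (length `m`) is within `β` of `1`,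
`‖(δ_ψV)(Γ) − ψ(Γ)‖ ≤ 2mβ · Σ_{b⊂Γ}‖ψ(b)‖` — the dressings `Ad` of the positively traversed letters and of the
tails are `1 + O(mβ)` (B7 p. 28: «the product over `b` replaced by the sum»). [cite: Balaban1985Averaging, p.28] -/
theorem norm_dhol_sub_asum_le [Nonempty n] {V : Site d → Fin d → 𝕄ˣ} (hV : IsUnitaryCfg V)
    (ψ : Site d → Fin d → 𝕄) {β : ℝ} (hβ : 0 ≤ β) :
    ∀ (x : Site d) (w : List (Letter d)), (∀ b ∈ bondsOf x w, ‖((V b.1 b.2 : 𝕄ˣ) : 𝕄) - 1‖ ≤ β) →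
      ‖dhol V ψ x w - asum ψ x w‖ ≤ 2 * w.length * β * lnorm ψ x w
  | x, [], _ => by simp
  | x, l :: w, h => by
    have hw : ∀ b ∈ bondsOf (x + l.vec) w, ‖((V b.1 b.2 : 𝕄ˣ) : 𝕄) - 1‖ ≤ β := fun b hb => h b (by simp [hb])
    have ih := norm_dhol_sub_asum_le hV ψ hβ (x + l.vec) w hw
    have hstepU : stepHol V x l ∈ unitaryUnits 𝕄 := by
      obtain ⟨μ, b⟩ := l
      cases b
      · exact (unitaryUnits 𝕄).inv_mem (hV _ μ)
      · exact hV x μ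
    have hU : ∀ x κ, V x κ ∈ U1 𝕄 := fun x κ => mem_U1_of_unitary (hV x κ)
    -- the step: `‖stepHol − 1‖ ≤ β`
    have hstep1 : ‖((stepHol V x l : 𝕄ˣ) : 𝕄) - 1‖ ≤ β := by
      have hb := h (if l.2 then (x, l.1) else (x + l.vec, l.1)) (by simp)
      obtain ⟨μ, b⟩ := l
      cases b
      · simp only [Bool.false_eq_true, ↓reduceIte] at hb
        simp only [stepHol, Bool.false_eq_true, ↓reduceIte]
        exact (norm_inv_sub_one_le (hU _ _)).trans hb
      · simpa [stepHol] using hb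
    -- the letter term: `‖dstep − stepA‖ ≤ 2β‖ψ_l‖`
    have hletter : ‖dstep V ψ x l - stepA ψ x l‖ ≤ 2 * β * ‖ψ (if l.2 then x else x + l.vec) l.1‖ := by
      obtain ⟨μ, b⟩ := l
      cases b
      · simp only [dstep, stepA, Bool.false_eq_true, ↓reduceIte, sub_self, norm_zero]
        positivity
      · simp only [dstep, stepA, ↓reduceIte]
        have hb := h (x, μ) (by simp)
        calc ‖Ad (V x μ) (ψ x μ) - ψ x μ‖ ≤ 2 * ‖((V x μ : 𝕄ˣ) : 𝕄) - 1‖ * ‖ψ x μ‖ := norm_Ad_sub_le (hV x μ) _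
          _ ≤ 2 * β * ‖ψ x μ‖ := by gcongr
    -- the tail dressing: `‖Ad_{step}(δ w) − δ w‖ ≤ 2β‖δ w‖ ≤ 2β·lnorm w`
    have htail : ‖Ad (stepHol V x l) (dhol V ψ (x + l.vec) w) - dhol V ψ (x + l.vec) w‖
        ≤ 2 * β * lnorm ψ (x + l.vec) w :=
      calc _ ≤ 2 * ‖((stepHol V x l : 𝕄ˣ) : 𝕄) - 1‖ * ‖dhol V ψ (x + l.vec) w‖ := norm_Ad_sub_le hstepU _
        _ ≤ 2 * β * lnorm ψ (x + l.vec) w := by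
            gcongr
            exact norm_dhol_le hV ψ _ w
    have e1 : dhol V ψ x (l :: w) - asum ψ x (l :: w)
        = (dstep V ψ x l - stepA ψ x l) + (Ad (stepHol V x l) (dhol V ψ (x + l.vec) w) - dhol V ψ (x + l.vec) w)
          + (dhol V ψ (x + l.vec) w - asum ψ (x + l.vec) w) := by
      rw [dhol_cons, asum_cons]; abel
    rw [e1, lnorm_cons, List.length_cons, Nat.cast_succ]
    have hl0 := lnorm_nonneg ψ (x + l.vec) w
    have hψ0 := norm_nonneg (ψ (if l.2 then x else x + l.vec) l.1)
    calc _ ≤ ‖dstep V ψ x l - stepA ψ x l‖ + ‖Ad (stepHol V x l) (dhol V ψ (x + l.vec) w) - dhol V ψ (x + l.vec) w‖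
          + ‖dhol V ψ (x + l.vec) w - asum ψ (x + l.vec) w‖ := norm_add₃_le
      _ ≤ 2 * β * ‖ψ (if l.2 then x else x + l.vec) l.1‖ + 2 * β * lnorm ψ (x + l.vec) w
          + 2 * w.length * β * lnorm ψ (x + l.vec) w := add_le_add (add_le_add hletter htail) ih
      _ ≤ 2 * (w.length + 1) * β * (‖ψ (if l.2 then x else x + l.vec) l.1‖ + lnorm ψ (x + l.vec) w) := by
          nlinarith [mul_nonneg hβ hl0, mul_nonneg hβ hψ0, mul_nonneg (mul_nonneg (Nat.cast_nonneg w.length) hβ) hψ0]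

/-- **Distance form**: if every bond starting within `ℓ¹`-distance `|Γ|` of `x` is within `β` of `1`, then
`‖(δ_ψV)(Γ) − ψ(Γ)‖ ≤ 2|Γ|β · Σ_{b⊂Γ}‖ψ(b)‖`. [folklore] -/
theorem norm_dhol_sub_asum_le_of_l1 [Nonempty n] {V : Site d → Fin d → 𝕄ˣ} (hV : IsUnitaryCfg V)
    (ψ : Site d → Fin d → 𝕄) {β : ℝ} (hβ : 0 ≤ β) (x : Site d) (w : List (Letter d))
    (h : ∀ (x' : Site d) (κ : Fin d), l1 (x' - x) ≤ w.length → ‖((V x' κ : 𝕄ˣ) : 𝕄) - 1‖ ≤ β) :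
    ‖dhol V ψ x w - asum ψ x w‖ ≤ 2 * w.length * β * lnorm ψ x w :=
  norm_dhol_sub_asum_le hV ψ hβ x w fun b hb => h b.1 b.2 (l1_le_of_mem_bondsOf x w b hb)

/-! ## §6 Tools for the consumers: `Ad` bookkeeping, covariant telescoping of a plaquette function along a word,
the Wilson-weight pairing against the flux, word sums against box sums -/

/-- `Ad_u (X + Y) = Ad_u X + Ad_u Y`. [folklore] -/
theorem Ad_add (u : 𝕄ˣ) (X Y : 𝕄) : Ad u (X + Y) = Ad u X + Ad u Y := by
  unfold Ad; rw [mul_add, add_mul]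

/-- `Ad_1 X = X`. [folklore] -/
theorem Ad_one (X : 𝕄) : Ad (1 : 𝕄ˣ) X = X := by
  unfold Ad; rw [inv_one, Units.val_one, one_mul, mul_one]

/-- `Ad_u 0 = 0`. [folklore] -/
@[simp] theorem Ad_zero (u : 𝕄ˣ) : Ad u (0 : 𝕄) = 0 := by simp [Ad]

/-- `Ad_u (−X) = −Ad_u X`. [folklore] -/
theorem Ad_neg (u : 𝕄ˣ) (X : 𝕄) : Ad u (-X) = -Ad u X := by
  unfold Ad; rw [mul_neg, neg_mul]

/-- `Ad_u (c • X) = c • Ad_u X` (complex scalars). [folklore] -/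
theorem Ad_smul (u : 𝕄ˣ) (c : ℂ) (X : 𝕄) : Ad u (c • X) = c • Ad u X := by
  unfold Ad; rw [Matrix.mul_smul, Matrix.smul_mul]

/-- `Ad_u (r • X) = r • Ad_u X` (real scalars). [folklore] -/
theorem Ad_real_smul (u : 𝕄ˣ) (r : ℝ) (X : 𝕄) : Ad u (r • X) = r • Ad u X := by
  rw [← Complex.coe_smul, Ad_smul, Complex.coe_smul]

/-- `Ad_u (Σ X_i) = Σ Ad_u X_i`. [folklore] -/
theorem Ad_sum {ι : Type*} (u : 𝕄ˣ) (s : Finset ι) (X : ι → 𝕄) : Ad u (∑ i ∈ s, X i) = ∑ i ∈ s, Ad u (X i) := by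
  unfold Ad; rw [Finset.mul_sum, Finset.sum_mul]

/-- `Ad_u X · Ad_u Y = Ad_u (X Y)`. [folklore] -/
theorem Ad_mul_Ad (u : 𝕄ˣ) (X Y : 𝕄) : Ad u X * Ad u Y = Ad u (X * Y) := by
  unfold Ad; simp only [mul_assoc, Units.inv_mul_cancel_left]

/-- `Re tr (Ad_u X) = Re tr X`. [folklore] -/
theorem nReTr_Ad (u : 𝕄ˣ) (X : 𝕄) : nReTr (Ad u X) = nReTr X := by
  unfold Ad; exact nReTr_conj (Units.inv_mul u)

/-- `|Re tr (X Y)| ≤ ‖X‖‖Y‖` (operator norm (19)). [folklore] -/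
theorem abs_nReTr_mul_le (X Y : 𝕄) : |nReTr (X * Y)| ≤ ‖X‖ * ‖Y‖ :=
  (MatrixNorms.abs_nReTr_le_opNorm _).trans (MatrixNorms.opNorm_mul_le X Y)

/-- **THE WILSON-WEIGHT PAIRING AGAINST THE FLUX**: for a skew `G` and a unit `C` with `‖C − 1‖ ≤ 1/4`,
`|Re tr(G C) − Re tr(G · log C)| ≤ 4‖C − 1‖² · ‖G‖` — `Re tr G = 0` and `C − 1 − log C = e^F − 1 − F = O(F²)`
(`F = log C`, `‖F‖ ≤ 2‖C − 1‖`).  This is the only matrix analysis the derivative of B11 (5)'s weight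
`−Re tr(G·V(∂p))` needs on the FINE side (the `a²‖d_Vψ‖_{ℓ¹}` slot of β). [cite: Balaban1985Variational, (5) p.278] -/
theorem abs_nReTr_mul_sub_mul_mlog_le {G : 𝕄} (hG : G ∈ skewAdjoint 𝕄) {C : 𝕄} (hC : ‖C - 1‖ ≤ 1 / 4) :
    |nReTr (G * C) - nReTr (G * mlog C)| ≤ 4 * ‖C - 1‖ ^ 2 * ‖G‖ := by
  set F := mlog C with hF
  have hFn : ‖F‖ ≤ 2 * ‖C - 1‖ := norm_mlog_le_two_mul (by linarith)
  have hF1 : ‖F‖ ≤ 1 := by linarith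
  have hexp : exp F = C := exp_mlog (by linarith)
  have hrem : ‖C - 1 - F‖ ≤ ‖F‖ ^ 2 := by
    rw [← hexp]
    exact (norm_exp_sub_one_le_of_norm_le le_rfl).2.trans (expRem_le_sq (norm_nonneg _) hF1)
  have e1 : G * C = G + G * F + G * (C - 1 - F) := by noncomm_ring
  have hlin : nReTr (G * C) = nReTr G + nReTr (G * F) + nReTr (G * (C - 1 - F)) := by
    rw [e1]; simp only [← nReTrL_apply, map_add]
  rw [hlin, nReTr_eq_zero_of_mem_skewAdjoint hG, zero_add, add_sub_cancel_left]
  calc |nReTr (G * (C - 1 - F))| ≤ ‖G‖ * ‖C - 1 - F‖ := abs_nReTr_mul_le _ _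
    _ ≤ ‖G‖ * ‖F‖ ^ 2 := by gcongr
    _ ≤ ‖G‖ * (2 * ‖C - 1‖) ^ 2 := by gcongr
    _ = 4 * ‖C - 1‖ ^ 2 * ‖G‖ := by ring

/-- **COVARIANT TELESCOPING of a plaquette function along a word**: for unitary `V` and any `F : Plaq → M_N`,
`‖Ad_{V(Γ)} F(x + disp Γ; π) − F(x; π)‖ ≤ Σ_{b ⊂ Γ} ‖(∇_V F)(b; π)‖` — each letter contributes one covariant
gradient, dressed by a unitary. [folklore] -/
theorem norm_Ad_hol_sub_le_sum_covGrad {V : Site d → Fin d → 𝕄ˣ} (hV : IsUnitaryCfg V)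
    (F : T4AveragingDeficitWall.Plaq d → 𝕄) (π : T4AveragingDeficitWall.Plane d) :
    ∀ (x : Site d) (w : List (Letter d)),
      ‖Ad (hol V x w) (F (x + disp w, π)) - F (x, π)‖
        ≤ ((bondsOf x w).map fun b => ‖covGrad V F b.1 b.2 π‖).sum
  | x, [] => by simp [Ad_one]
  | x, l :: w => by
    rw [hol_cons, disp_cons, bondsOf_cons, List.map_cons, List.sum_cons, Ad_mul]
    have ih := norm_Ad_hol_sub_le_sum_covGrad hV F π (x + l.vec) w
    rw [show x + (l.vec + disp w) = x + l.vec + disp w by abel]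
    have hstepU : stepHol V x l ∈ unitaryUnits 𝕄 := by
      obtain ⟨μ, b⟩ := l
      cases b
      · exact (unitaryUnits 𝕄).inv_mem (hV _ μ)
      · exact hV x μ
    -- split: `Ad_s (Ad_h F' − F(x+l)) + (Ad_s F(x+l) − F(x))`
    have e1 : Ad (stepHol V x l) (Ad (hol V (x + l.vec) w) (F (x + l.vec + disp w, π))) - F (x, π)
        = Ad (stepHol V x l) (Ad (hol V (x + l.vec) w) (F (x + l.vec + disp w, π)) - F (x + l.vec, π))
          + (Ad (stepHol V x l) (F (x + l.vec, π)) - F (x, π)) := by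
      rw [Ad_sub]; abel
    rw [e1]
    refine (norm_add_le _ _).trans ?_
    rw [add_comm]
    refine add_le_add ?_ ?_
    · -- the letter's own covariant gradient
      obtain ⟨μ, b⟩ := l
      cases b
      · simp only [stepHol, Bool.false_eq_true, ↓reduceIte, Letter.vec_false]
        -- `Ad_{V⁻¹} F(x − e) − F(x) = −Ad_{V⁻¹}(Ad_V F(x) − F(x−e))`
        have e2 : Ad (V (x + -e μ) μ)⁻¹ (F (x + -e μ, π)) - F (x, π)
            = -Ad (V (x + -e μ) μ)⁻¹ (covGrad V F (x + -e μ) μ π) := by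
          rw [covGrad, Ad_sub, ← Ad_mul, inv_mul_cancel, Ad_one, show x + -e μ + e μ = x by abel]
          abel
        rw [e2, norm_neg, norm_Ad_of_unitary ((unitaryUnits 𝕄).inv_mem (hV _ μ))]
      · simp only [stepHol, ↓reduceIte, Letter.vec_true]
        rw [← covGrad]
    · rw [norm_Ad_of_unitary hstepU]
      exact ih

/-- **A WORD SUM AGAINST A BOX SUM**: if every bond of `Γ` lies in the finite bond set `T`, then
`Σ_{b⊂Γ}‖ψ(b)‖ ≤ |Γ| · Σ_{b∈T}‖ψ(b)‖` (crude multiplicity `|Γ|`). [folklore] -/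
theorem lnorm_le_length_mul_sum (ψ : Site d → Fin d → 𝕄) (T : Finset (Site d × Fin d)) :
    ∀ (x : Site d) (w : List (Letter d)), (∀ b ∈ bondsOf x w, b ∈ T) →
      lnorm ψ x w ≤ w.length * ∑ b ∈ T, ‖ψ b.1 b.2‖
  | x, [], _ => by simp
  | x, l :: w, h => by
    rw [lnorm_cons, List.length_cons, Nat.cast_succ, add_mul, one_mul, add_comm]
    have ih := lnorm_le_length_mul_sum ψ T (x + l.vec) w fun b hb => h b (by simp [hb])
    refine add_le_add ih ?_
    have hb := h (if l.2 then (x, l.1) else (x + l.vec, l.1)) (by simp)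
    have key : ‖ψ (if l.2 then x else x + l.vec) l.1‖
        = ‖ψ (if l.2 then (x, l.1) else (x + l.vec, l.1)).1 (if l.2 then (x, l.1) else (x + l.vec, l.1)).2‖ := by
      obtain ⟨μ, b⟩ := l; cases b <;> rfl
    rw [key]
    exact Finset.single_le_sum (f := fun b : Site d × Fin d => ‖ψ b.1 b.2‖) (fun _ _ => norm_nonneg _) hb

/-- The same for a list sum of covariant gradients: `Σ_{b⊂Γ}‖∇_VF(b;π)‖ ≤ |Γ|·Σ_{b∈T}‖∇_VF(b;π)‖`. [folklore] -/
theorem sum_bondsOf_le_length_mul_sum (g : Site d × Fin d → ℝ) (hg : ∀ b, 0 ≤ g b) (T : Finset (Site d × Fin d)) :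
    ∀ (x : Site d) (w : List (Letter d)), (∀ b ∈ bondsOf x w, b ∈ T) →
      ((bondsOf x w).map g).sum ≤ w.length * ∑ b ∈ T, g b
  | x, [], _ => by simp
  | x, l :: w, h => by
    rw [bondsOf_cons, List.map_cons, List.sum_cons, List.length_cons, Nat.cast_succ, add_mul, one_mul, add_comm]
    have ih := sum_bondsOf_le_length_mul_sum g hg T (x + l.vec) w fun b hb => h b (by simp [hb])
    exact add_le_add ih (Finset.single_le_sum (f := g) (fun _ _ => hg _)
      (h (if l.2 then (x, l.1) else (x + l.vec, l.1)) (by simp)))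

end

end Summit.QuantumFields.BalabanUV.T4Continuum.AveragingDeficitNearIdentity
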